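import Summits.ResolutionOfSingularities.ResolutionOfSingularities.Theorems.WeightedInvariantIota3FlagDeltaBridgeDefs
import HarnessLib

/-!
# R10b FLAG–δ BRIDGE (PART 2 of 2, def-free): HIRONAKA'S VERTEX THEOREM (4.8) AS DOMINANCE OF TRANSLATES, the bridge
# `F_(X; C u₁)(r₁ ν) ∋ h ↔ δ_α(h; u; X) ≥ 1` (`coe_mem_flagContactFiltration_iff_deltaGE`, `flagDeltaBridge_holds`), and
# `flagContactFiltration_eq_monomialIdeal`: the intrinsic two-flag filtration IS a three-parameter monomial ideal in ANY local `S`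

**Provenance / honest framing** — as in PART 1 (`…Iota3FlagDeltaBridgeDefs`): VERBATIM PORT of res-L1-w43-idea-2's Sketch-R10b rev 3
(49910a960c44be17), namespace `…LocalEngine.Iota3`, dealt by res-L1-w43-plan-1 (STATUS 2026-08-27T21:18:33Z; door `stmt-ResolutionOfSingularities-19897`,
consumer res-D-brk-1), ported by res-L1-type-o4, `--supports stmt-ResolutionOfSingularities-19897 --as helper`. [OURS · L1 w43 · idea-2 R10b] OURS
elementary commutative algebra over Mathlib, the tree's `flagContactFiltration` and the LANDED Cossart–Piltant calculus; NOT a statement of H. Hironaka's 2017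
manuscript (nothing of it asserted or used); no Literature fact introduced; AI-written/ported, weaker than expert review; no progress claim.

## Contents (Sketch-R10b §1, §3a–§3d verbatim; the defs are in PART 1 `…FlagDeltaBridgeDefs`)
* §1 `IsMinimal.mem_monomialIdeal_of_deltaGE_taylor` / `IsMinimal.sub_mem_monomialIdeal_of_deltaGE_taylor` — corollaries of the tree's
  `CossartPiltant.exists_isSolvableVertex_taylor_neg` [cite: Hironaka1967 Thm. (4.8); CossartPiltant2019 Prop. 2.2 (2); CossartJannsenSaito2020 Thm. 8.16]:
  if `h ∈ S[X]` is monic with no solvable vertex and `h(X + φ)` has `δ_α ≥ q`, then `φ ∈ monomialIdeal u α q`.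
* §3a–§3d: `coeffIdeal_mul_le`, `maximalIdeal_pow_le_coeffIdeal`, `pow_mem_monomialIdeal_weight`, `flagContactFiltration_le_coeffIdeal`,
  `C_mul_X_pow_mem_flagContactFiltration`, **`coe_mem_flagContactFiltration_iff_deltaGE`**, **`flagDeltaBridge_holds`**, **`flagContactFiltration_eq_monomialIdeal`**
  (not ported: the sketch's closing doc-carrier `hironakaHubDictionary : True`; one lint fix: unused binders `a b` ↦ `_ _` in a statement lambda).
-/

noncomputable section

open Polynomial IsLocalRing
open Literature.AlgebraicGeometry.Resolution.CossartPiltant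
open Summit.ResolutionOfSingularities.ResolutionOfSingularities.Theorems

set_option linter.dupNamespace false

namespace Summit.ResolutionOfSingularities.ResolutionOfSingularities.Cruxes.HypersurfaceCentreConstruction.LocalEngine.Iota3

/-! ## §1 Hironaka (4.8) as dominance of translates -/

section Dominance

universe u

variable {S : Type u} [CommRing S] {N : ℕ}

/-- **DOMINANCE OF TRANSLATES OF A MINIMAL MONIC POLYNOMIAL** (corollary of the tree's Hironaka (4.8)).  If `h ∈ S[X]` is monic of
degree `≥ 1` with no solvable vertex w.r.t. `(u; X)` and the translate `h(X + φ)` has `δ_α ≥ q`, then `φ` lies in the monomial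
`u`-ideal of `α`-weight `≥ q`. [OURS · R10b · corollary of `CossartPiltant.exists_isSolvableVertex_taylor_neg`;
cite: Hironaka1967 Thm. (4.8); CossartPiltant2019 Prop. 2.2 (2); CossartJannsenSaito2020 Thm. 8.16] -/
theorem IsMinimal.mem_monomialIdeal_of_deltaGE_taylor [IsNoetherianRing S] [IsLocalRing S] {u : Fin N → S}
    (H : ∀ (i : Fin N) (T : Finset (Fin N)), i ∉ T →
      ∀ y, u i * y ∈ Ideal.span (u '' ↑T) → y ∈ Ideal.span (u '' ↑T))
    (hu : ∀ i, u i ∈ maximalIdeal S) (hrad : (Ideal.span (Set.range u)).IsRadical)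
    {h : S[X]} (hh : h.Monic) (hm : 1 ≤ h.natDegree) (hmin : IsMinimal u h) (φ : S)
    {α : Fin N → ℝ} (hα : ∀ j, 0 < α j) {q : ℝ} (hq : DeltaGE u α (taylor φ h) q) :
    φ ∈ monomialIdeal u α q := by
  obtain ⟨-, hφP, hPmin⟩ := minExponents_spec' u H hu φ
  rw [mem_monomialIdeal_iff_of_minimal u (fun j => (hα j).le) hφP hPmin]
  intro b hb
  by_contra hbq
  push Not at hbq
  have hhφ : (taylor φ h).Monic := by
    rw [Monic, leadingCoeff_taylor]
    exact hh
  have hm1 : 1 ≤ (taylor φ h).natDegree := by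
    rw [natDegree_taylor]
    exact hm
  obtain ⟨x, hx⟩ := exists_isSolvableVertex_taylor_neg u H hu hrad hhφ hm1 hα hq hb hbq
  rw [taylor_taylor, neg_add_cancel, taylor_zero] at hx
  exact hmin x hx

/-- The same between TWO translates: if `h(X + θ)` is minimal and `h(X + θ')` reaches `δ_α ≥ q`, then `θ' - θ ∈ monomialIdeal u α q`
(apply the corollary to the minimal `h(X + θ)` and `φ = θ' - θ`). [OURS · R10b] -/
theorem IsMinimal.sub_mem_monomialIdeal_of_deltaGE_taylor [IsNoetherianRing S] [IsLocalRing S] {u : Fin N → S}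
    (H : ∀ (i : Fin N) (T : Finset (Fin N)), i ∉ T →
      ∀ y, u i * y ∈ Ideal.span (u '' ↑T) → y ∈ Ideal.span (u '' ↑T))
    (hu : ∀ i, u i ∈ maximalIdeal S) (hrad : (Ideal.span (Set.range u)).IsRadical)
    {h : S[X]} (hh : h.Monic) (hm : 1 ≤ h.natDegree) {θ θ' : S} (hmin : IsMinimal u (taylor θ h))
    {α : Fin N → ℝ} (hα : ∀ j, 0 < α j) {q : ℝ} (hq : DeltaGE u α (taylor θ' h) q) :
    θ' - θ ∈ monomialIdeal u α q := by
  have hhθ : (taylor θ h).Monic := by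
    rw [Monic, leadingCoeff_taylor]
    exact hh
  have hmθ : 1 ≤ (taylor θ h).natDegree := by
    rw [natDegree_taylor]
    exact hm
  have hq' : DeltaGE u α (taylor (θ' - θ) (taylor θ h)) q := by
    rw [taylor_taylor, sub_add_cancel]
    exact hq
  exact IsMinimal.mem_monomialIdeal_of_deltaGE_taylor H hu hrad hhθ hmθ hmin (θ' - θ) hα hq'

end Dominance

/-! ## §3 The bridge (rev 3) -/

/-! ### §3a Coefficientwise ideals of `S₀⟦X⟧` -/

section CoeffIdeal

variable {S₀ : Type*} [CommRing S₀]

/-- Convolution: `J(I) · J(I') ⊆ J(I'')` whenever `I a · I' b ⊆ I'' (a + b)`. [OURS · R10b §3a · bookkeeping] -/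
theorem coeffIdeal_mul_le {I I' I'' : ℕ → Ideal S₀} (hI : Monotone I) (hI' : Monotone I') (hI'' : Monotone I'')
    (h : ∀ a b, I a * I' b ≤ I'' (a + b)) :
    coeffIdeal I hI * coeffIdeal I' hI' ≤ coeffIdeal I'' hI'' := by
  refine Ideal.mul_le.mpr fun f hf g hg => ?_
  rw [mem_coeffIdeal]
  intro j
  rw [PowerSeries.coeff_mul]
  refine (I'' j).sum_mem fun p hp => ?_
  have hpj : p.1 + p.2 = j := Finset.HasAntidiagonal.mem_antidiagonal.mp hp
  exact hpj ▸ h p.1 p.2 (Ideal.mul_mem_mul (hf p.1) (hg p.2))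

variable [IsLocalRing S₀]

/-- `f ∈ 𝔪_{S₀⟦X⟧} ↔ f(0) ∈ 𝔪_{S₀}`. [folklore] -/
theorem mem_maximalIdeal_powerSeries_iff {f : PowerSeries S₀} :
    f ∈ maximalIdeal (PowerSeries S₀) ↔ PowerSeries.constantCoeff f ∈ maximalIdeal S₀ := by
  simp only [IsLocalRing.mem_maximalIdeal, mem_nonunits_iff, PowerSeries.isUnit_iff_constantCoeff]

/-- `𝔪 ⊆ J(𝔪₀^(1 - ·))`: the constant coefficient of an element of `𝔪_{S₀⟦X⟧}` lies in `𝔪_{S₀}`. [OURS · R10b §3a · bookkeeping] -/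
theorem maximalIdeal_le_coeffIdeal_one :
    maximalIdeal (PowerSeries S₀) ≤ coeffIdeal (mPowCoeff S₀ 1) (mPowCoeff_mono 1) := by
  intro f hf
  rw [mem_coeffIdeal]
  intro j
  rcases j with _ | j
  · simpa [mPowCoeff] using (mem_maximalIdeal_powerSeries_iff.mp hf)
  · simp [mPowCoeff]

/-- **`𝔪^e ⊆ J(𝔪₀^(e - ·))`**: the `j`-th coefficient of an element of `𝔪_{S₀⟦X⟧}^e` lies in `𝔪_{S₀}^(e-j)`. [OURS · R10b §3a] -/
theorem maximalIdeal_pow_le_coeffIdeal (e : ℕ) :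
    maximalIdeal (PowerSeries S₀) ^ e ≤ coeffIdeal (mPowCoeff S₀ e) (mPowCoeff_mono e) := by
  induction e with
  | zero =>
    intro f _
    rw [mem_coeffIdeal]
    intro j
    simp [mPowCoeff]
  | succ e ih =>
    rw [pow_succ]
    refine (Ideal.mul_mono ih maximalIdeal_le_coeffIdeal_one).trans ?_
    refine coeffIdeal_mul_le _ _ _ fun a b => ?_
    simp only [mPowCoeff, ← pow_add]
    exact Ideal.pow_le_pow_right (by omega)

end CoeffIdeal

/-! ### §3b Weighted monomial ideals: two small lemmas -/

section Weights

variable {S : Type*} [CommRing S] {N : ℕ}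

/-- `(u)^t ⊆ I_α(c t)` when `0 ≤ c ≤ α_j` for all `j`. [OURS · R10b §3b · after CossartPiltant2019 Ch. 2 (v1 p. 9)] -/
theorem span_pow_le_monomialIdeal_of_le (u : Fin N → S) {α : Fin N → ℝ} {c : ℝ} (hc : 0 ≤ c)
    (hα : ∀ j, c ≤ α j) (t : ℕ) :
    Ideal.span (Set.range u) ^ t ≤ monomialIdeal u α (c * t) := by
  refine (span_pow_le_monomialIdeal_one u t).trans ?_
  apply Ideal.span_mono
  rintro m ⟨x, hx, rfl⟩
  refine ⟨x, ?_, rfl⟩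
  calc c * t ≤ c * weight (fun _ => (1 : ℝ)) x := mul_le_mul_of_nonneg_left hx hc
    _ = ∑ j, c * (x j : ℝ) := by simp [weight, Finset.mul_sum]
    _ ≤ ∑ j, α j * (x j : ℝ) := Finset.sum_le_sum fun j _ => mul_le_mul_of_nonneg_right (hα j) (Nat.cast_nonneg _)
    _ = weight α x := rfl

/-- `u_j^b ∈ I_α(α_j b)`. [OURS · R10b §3b] -/
theorem pow_mem_monomialIdeal_weight (u : Fin N → S) (α : Fin N → ℝ) (j : Fin N) (b : ℕ) :
    u j ^ b ∈ monomialIdeal u α (α j * b) := by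
  have hw : ∀ b : ℕ, weight α (b • Pi.single j 1) = α j * b := by
    intro b
    induction b with
    | zero => simp
    | succ b ih => rw [succ_nsmul, weight_add, weight_single, ih]; push_cast; ring
  have h1 : ∀ b : ℕ, u j ^ b = uPow u (b • Pi.single j 1) := by
    intro b
    induction b with
    | zero => simp
    | succ b ih => rw [pow_succ, ih, succ_nsmul, uPow_add, uPow_single]
  rw [h1]
  exact uPow_mem_monomialIdeal u (le_of_eq (hw b).symm)

end Weights

/-! ### §3c The bridge -/

section Bridge

variable {S₀ : Type*} [CommRing S₀] [IsLocalRing S₀]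

/-- **BRIDGE, direction `⊆`**: `F(r₁ ν) ⊆ J(j ↦ I_α(ν − j))` for the flag `(X; C u₁)` of `S₀⟦X⟧`, `𝔪_{S₀} = (u₀, u₁)`, `0 < q ≤ r₂ ≤ r₁`.
[OURS · R10b §3c] -/
theorem flagContactFiltration_le_coeffIdeal (u : Fin 2 → S₀) (hm : maximalIdeal S₀ = Ideal.span (Set.range u))
    {q r₁ r₂ : ℕ} (hadm : AdmissibleTriple q r₁ r₂) (ν : ℕ) :
    flagContactFiltration (PowerSeries.X : PowerSeries S₀) (PowerSeries.C (u 1)) q r₁ r₂ (r₁ * ν) ≤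
      coeffIdeal (fun j => monomialIdeal u (bridgeWeights q r₁ r₂) ((ν : ℝ) - j))
        (fun _ _ hab => monomialIdeal_antitone u _ (sub_le_sub_left (Nat.cast_le.mpr hab) _)) := by
  obtain ⟨hq, hqr₂, hr₂r₁⟩ := hadm
  have hr₁ : (0 : ℝ) < r₁ := by exact_mod_cast (lt_of_lt_of_le hq (hqr₂.trans hr₂r₁))
  have hc : (0 : ℝ) ≤ (q : ℝ) / r₁ := by positivity
  have hcα : ∀ j, (q : ℝ) / r₁ ≤ bridgeWeights q r₁ r₂ j := by
    intro j
    fin_cases j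
    · simp
    · show (q : ℝ) / r₁ ≤ bridgeWeights q r₁ r₂ 1
      rw [bridgeWeights_one]
      exact div_le_div_of_nonneg_right (by exact_mod_cast hqr₂) hr₁.le
  rw [flagContactFiltration_def]
  refine iSup_le fun a => iSup_le fun b => ?_
  refine Ideal.mul_le.mpr fun s hs g hg => ?_
  obtain ⟨t, rfl⟩ := Ideal.mem_span_singleton'.mp hs
  set e := (r₁ * ν - r₁ * a - r₂ * b + q - 1) / q with he
  have hg' : t * g ∈ maximalIdeal (PowerSeries S₀) ^ e := Ideal.mul_mem_left _ _ hg
  have hcoef := mem_coeffIdeal.mp (maximalIdeal_pow_le_coeffIdeal e hg')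
  have hEq : t * (PowerSeries.X ^ a * PowerSeries.C (u 1) ^ b) * g =
      PowerSeries.X ^ a * (PowerSeries.C (u 1 ^ b) * (t * g)) := by
    rw [map_pow]; ring
  rw [hEq, mem_coeffIdeal]
  intro j
  rw [PowerSeries.coeff_X_pow_mul']
  split_ifs with haj
  · rw [PowerSeries.coeff_C_mul]
    -- `u₁^b · c` with `c ∈ 𝔪₀^(e - (j - a))`
    have hcj := hcoef (j - a)
    simp only [mPowCoeff] at hcj
    set d := j - a with hd
    set tt := e - d with htt
    have h1 : u 1 ^ b ∈ monomialIdeal u (bridgeWeights q r₁ r₂) ((r₂ : ℝ) / r₁ * b) := by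
      simpa using pow_mem_monomialIdeal_weight u (bridgeWeights q r₁ r₂) 1 b
    have h2 : PowerSeries.coeff d (t * g) ∈ monomialIdeal u (bridgeWeights q r₁ r₂) ((q : ℝ) / r₁ * tt) := by
      refine span_pow_le_monomialIdeal_of_le u hc hcα tt ?_
      rw [← hm]
      exact hcj
    have h12 := monomialIdeal_mul_le u (bridgeWeights q r₁ r₂) _ _ (Ideal.mul_mem_mul h1 h2)
    refine monomialIdeal_antitone u _ ?_ h12
    -- the arithmetic: `ν - j ≤ (r₂ b + q tt)/r₁`
    have hme : r₁ * ν - r₁ * a - r₂ * b ≤ q * e := by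
      have h0 := Nat.lt_div_mul_add (a := r₁ * ν - r₁ * a - r₂ * b + q - 1) hq
      rw [← he, Nat.mul_comm e q] at h0
      omega
    have hE : q * e ≤ q * tt + q * d := by
      rw [← mul_add]
      exact Nat.mul_le_mul_left q (by omega)
    have hqd : q * d ≤ r₁ * d := Nat.mul_le_mul_right d (hqr₂.trans hr₂r₁)
    have hjd : r₁ * j = r₁ * a + r₁ * d := by rw [hd, ← mul_add]; congr 1; omega
    have hN : r₁ * ν ≤ r₁ * j + r₂ * b + q * tt := by omega
    have hR : (r₁ : ℝ) * ν ≤ r₁ * j + r₂ * b + q * tt := by exact_mod_cast hN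
    rw [div_mul_eq_mul_div, div_mul_eq_mul_div, ← add_div, le_div_iff₀ hr₁]
    linarith
  · simp

/-- **BRIDGE, direction `⊇`** (generators): `C c · X^i ∈ F(r₁ ν)` for `c ∈ I_α(ν − i)`, `i ≤ ν`. [OURS · R10b §3c] -/
theorem C_mul_X_pow_mem_flagContactFiltration (u : Fin 2 → S₀) (hm : maximalIdeal S₀ = Ideal.span (Set.range u))
    {q r₁ r₂ : ℕ} (hadm : AdmissibleTriple q r₁ r₂) {ν i : ℕ} (hi : i ≤ ν) {c : S₀}
    (hc : c ∈ monomialIdeal u (bridgeWeights q r₁ r₂) (((ν - i : ℕ) : ℝ))) :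
    PowerSeries.C c * PowerSeries.X ^ i ∈
      flagContactFiltration (PowerSeries.X : PowerSeries S₀) (PowerSeries.C (u 1)) q r₁ r₂ (r₁ * ν) := by
  obtain ⟨hq, hqr₂, hr₂r₁⟩ := hadm
  have hr₁ : (0 : ℝ) < r₁ := by exact_mod_cast (lt_of_lt_of_le hq (hqr₂.trans hr₂r₁))
  have hu0 : PowerSeries.C (u 0) ∈ maximalIdeal (PowerSeries S₀) := by
    rw [mem_maximalIdeal_powerSeries_iff, PowerSeries.constantCoeff_C, hm]
    exact Ideal.subset_span ⟨0, rfl⟩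
  induction hc using Submodule.span_induction with
  | mem m hmm =>
    obtain ⟨x, hx, rfl⟩ := hmm
    rw [weight_bridgeWeights, Nat.cast_sub hi] at hx
    -- `r₁ (ν - i) ≤ q x₀ + r₂ x₁`
    have hR : (r₁ : ℝ) * ν ≤ r₁ * i + q * x 0 + r₂ * x 1 := by
      have := (le_div_iff₀ hr₁).mp (show ((ν : ℝ) - i) ≤ ((q : ℝ) * x 0 + r₂ * x 1) / r₁ by
        rw [add_div, ← div_mul_eq_mul_div, ← div_mul_eq_mul_div]; exact hx)
      linarith
    have hN : r₁ * ν ≤ r₁ * i + q * x 0 + r₂ * x 1 := by exact_mod_cast hR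
    have huPow : uPow u x = u 0 ^ x 0 * u 1 ^ x 1 := by simp [uPow, Fin.prod_univ_two]
    rw [huPow, map_mul, map_pow, map_pow]
    have hEq : PowerSeries.C (u 0) ^ x 0 * PowerSeries.C (u 1) ^ x 1 * PowerSeries.X ^ i =
        PowerSeries.X ^ i * PowerSeries.C (u 1) ^ x 1 * PowerSeries.C (u 0) ^ x 0 := by ring
    rw [hEq, flagContactFiltration_def]
    refine Submodule.mem_iSup_of_mem i (Submodule.mem_iSup_of_mem (x 1) ?_)
    refine Ideal.mul_mem_mul (Ideal.mem_span_singleton_self _) ?_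
    have he : (r₁ * ν - r₁ * i - r₂ * x 1 + q - 1) / q ≤ x 0 := by
      refine Nat.lt_succ_iff.mp ((Nat.div_lt_iff_lt_mul hq).mpr ?_)
      have : (x 0 + 1) * q = q * x 0 + q := by ring
      rw [Nat.succ_eq_add_one, this]
      omega
    exact Ideal.pow_le_pow_right he (Ideal.pow_mem_pow hu0 _)
  | zero => simp
  | add c d _ _ hc hd =>
    rw [map_add, add_mul]
    exact Ideal.add_mem _ hc hd
  | smul s c _ hc =>
    rw [smul_eq_mul, map_mul, mul_assoc]
    exact Ideal.mul_mem_left _ _ hc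

/-- **THE BRIDGE (R10b §3 · OURS · PROVED)**: for a monic `h ∈ S₀[X]` of degree `ν`, `𝔪_{S₀} = (u₀, u₁)`, `0 < q ≤ r₂ ≤ r₁`:
`h ∈ F_{(X; C u₁)}(r₁ ν) ⊆ S₀⟦X⟧ ↔ δ_α(h; u; X) ≥ 1` with `α = (q/r₁, r₂/r₁)` — the intrinsic two-flag filtration (res-D-brk-1) meets
Cossart–Piltant's `DeltaGE`.  (Monicity is not even needed.) [OURS · R10b §3c] -/
theorem coe_mem_flagContactFiltration_iff_deltaGE (u : Fin 2 → S₀) (hm : maximalIdeal S₀ = Ideal.span (Set.range u))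
    {q r₁ r₂ : ℕ} (hadm : AdmissibleTriple q r₁ r₂) (h : S₀[X]) :
    ((h : PowerSeries S₀) ∈ flagContactFiltration (PowerSeries.X : PowerSeries S₀) (PowerSeries.C (u 1)) q r₁ r₂ (r₁ * h.natDegree)
      ↔ DeltaGE u (bridgeWeights q r₁ r₂) h 1) := by
  constructor
  · intro hmem i hi
    rw [Finset.mem_Icc] at hi
    have hc := mem_coeffIdeal.mp (flagContactFiltration_le_coeffIdeal u hm hadm h.natDegree hmem) (h.natDegree - i)
    rw [Polynomial.coeff_coe, Nat.cast_sub hi.2] at hc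
    simpa using hc
  · intro hδ
    have hsum : ((h : S₀[X]) : PowerSeries S₀) =
        ∑ j ∈ Finset.range (h.natDegree + 1), PowerSeries.C (h.coeff j) * PowerSeries.X ^ j := by
      have := congrArg (Polynomial.coeToPowerSeries.ringHom (R := S₀)) h.as_sum_range_C_mul_X_pow
      simpa [map_sum, Polynomial.coeToPowerSeries.ringHom_apply, Polynomial.coe_C, Polynomial.coe_X] using this
    rw [hsum]
    refine Ideal.sum_mem _ fun j hj => ?_
    rw [Finset.mem_range] at hj
    refine C_mul_X_pow_mem_flagContactFiltration u hm hadm (Nat.le_of_lt_succ hj) ?_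
    by_cases hjν : j = h.natDegree
    · rw [hjν, Nat.sub_self, Nat.cast_zero, monomialIdeal_of_nonpos u _ le_rfl]
      exact Submodule.mem_top
    · have hk : 1 ≤ h.natDegree - j ∧ h.natDegree - j ≤ h.natDegree := by omega
      have := hδ (h.natDegree - j) (Finset.mem_Icc.mpr hk)
      rw [mul_one, show h.natDegree - (h.natDegree - j) = j by omega] at this
      exact this

/-- `FlagDeltaBridge` (the candidate of rev 2) HOLDS — for every local `S₀`, with hypothesis (H) unused. [OURS · R10b §3c] -/
theorem flagDeltaBridge_holds' (S₀ : Type) [CommRing S₀] [IsLocalRing S₀] :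
    ∀ (u : Fin 2 → S₀) (h : S₀[X]) (q r₁ r₂ : ℕ), h.Monic → AdmissibleTriple q r₁ r₂ →
    maximalIdeal S₀ = Ideal.span (Set.range u) →
    (∀ (i : Fin 2) (T : Finset (Fin 2)), i ∉ T → ∀ y, u i * y ∈ Ideal.span (u '' ↑T) → y ∈ Ideal.span (u '' ↑T)) →
    ((h : PowerSeries S₀) ∈ flagContactFiltration (PowerSeries.X : PowerSeries S₀) (PowerSeries.C (u 1)) q r₁ r₂ (r₁ * h.natDegree)
      ↔ DeltaGE u (fun i => if i = 0 then (q : ℝ) / r₁ else (r₂ : ℝ) / r₁) h 1) := by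
  intro u h q r₁ r₂ _ hadm hm _
  exact coe_mem_flagContactFiltration_iff_deltaGE u hm hadm h

/-- **`FlagDeltaBridge` HOLDS** for every local `S₀` (monicity and (H) unused). [OURS · R10b §3c · PROVED] -/
theorem flagDeltaBridge_holds (S₀ : Type) [CommRing S₀] [IsLocalRing S₀] : FlagDeltaBridge S₀ :=
  flagDeltaBridge_holds' S₀

end Bridge

/-! ### §3d The intrinsic two-flag filtration IS a three-parameter monomial ideal (any local `S`) -/

section Intrinsic

variable {S : Type*} [CommRing S] [IsLocalRing S]

/-- **INTRINSIC = MONOMIAL (R10b §3d · OURS · PROVED)**: in a local ring `S` with `𝔪 = (u₀, u₁, u₂) = (x, g₂, g₁)` and `0 < q ≤ r₂ ≤ r₁`,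
res-D-brk-1's two-flag filtration of the flag `(g₁; g₂) = (u₂; u₁)` is Cossart–Piltant's monomial ideal of the frame `u` with weights
`(q, r₂, r₁)`:  `F_{(g₁; g₂)}(n) = I_{(q, r₂, r₁)}(u; n)`.  No coefficient ring, no completeness. [OURS · R10b §3d] -/
theorem flagContactFiltration_eq_monomialIdeal (u : Fin 3 → S) (hm : maximalIdeal S = Ideal.span (Set.range u))
    {q r₁ r₂ : ℕ} (hadm : AdmissibleTriple q r₁ r₂) (n : ℕ) :
    flagContactFiltration (u 2) (u 1) q r₁ r₂ n = monomialIdeal u (frameWeights q r₁ r₂) n := by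
  obtain ⟨hq, hqr₂, hr₂r₁⟩ := hadm
  have hc : (0 : ℝ) ≤ (q : ℝ) := by positivity
  have hcα : ∀ j, (q : ℝ) ≤ frameWeights q r₁ r₂ j := by
    intro j
    fin_cases j
    · simp
    · simpa using (show (q : ℝ) ≤ r₂ by exact_mod_cast hqr₂)
    · simpa using (show (q : ℝ) ≤ r₁ by exact_mod_cast (hqr₂.trans hr₂r₁))
  apply le_antisymm
  · rw [flagContactFiltration_def]
    refine iSup_le fun a => iSup_le fun b => ?_
    set e := (n - r₁ * a - r₂ * b + q - 1) / q with he
    have h1 : u 2 ^ a * u 1 ^ b ∈ monomialIdeal u (frameWeights q r₁ r₂) ((r₁ : ℝ) * a + (r₂ : ℝ) * b) := by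
      have ha := pow_mem_monomialIdeal_weight u (frameWeights q r₁ r₂) 2 a
      have hb := pow_mem_monomialIdeal_weight u (frameWeights q r₁ r₂) 1 b
      simp only [frameWeights_two, frameWeights_one] at ha hb
      exact monomialIdeal_mul_le u _ _ _ (Ideal.mul_mem_mul ha hb)
    have h2 : maximalIdeal S ^ e ≤ monomialIdeal u (frameWeights q r₁ r₂) ((q : ℝ) * e) := by
      rw [hm]
      exact span_pow_le_monomialIdeal_of_le u hc hcα e
    calc Ideal.span {u 2 ^ a * u 1 ^ b} * maximalIdeal S ^ e
        ≤ monomialIdeal u (frameWeights q r₁ r₂) ((r₁ : ℝ) * a + (r₂ : ℝ) * b) *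
            monomialIdeal u (frameWeights q r₁ r₂) ((q : ℝ) * e) :=
          Ideal.mul_mono ((Ideal.span_singleton_le_iff_mem _).mpr h1) h2
      _ ≤ monomialIdeal u (frameWeights q r₁ r₂) ((r₁ : ℝ) * a + (r₂ : ℝ) * b + (q : ℝ) * e) := monomialIdeal_mul_le u _ _ _
      _ ≤ monomialIdeal u (frameWeights q r₁ r₂) n := monomialIdeal_antitone u _ ?_
    have hme : n - r₁ * a - r₂ * b ≤ q * e := by
      have h0 := Nat.lt_div_mul_add (a := n - r₁ * a - r₂ * b + q - 1) hq
      rw [← he, Nat.mul_comm e q] at h0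
      omega
    have hN : n ≤ r₁ * a + r₂ * b + q * e := by omega
    exact_mod_cast hN
  · rw [monomialIdeal, Ideal.span_le]
    rintro m ⟨x, hx, rfl⟩
    rw [weight_frameWeights] at hx
    have hN : n ≤ q * x 0 + r₂ * x 1 + r₁ * x 2 := by exact_mod_cast hx
    have huPow : uPow u x = u 2 ^ x 2 * u 1 ^ x 1 * u 0 ^ x 0 := by
      simp [uPow, Fin.prod_univ_three]; ring
    rw [SetLike.mem_coe, huPow, flagContactFiltration_def]
    refine Submodule.mem_iSup_of_mem (x 2) (Submodule.mem_iSup_of_mem (x 1) ?_)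
    refine Ideal.mul_mem_mul (Ideal.mem_span_singleton_self _) ?_
    have hu0 : u 0 ∈ maximalIdeal S := by rw [hm]; exact Ideal.subset_span ⟨0, rfl⟩
    have he : (n - r₁ * x 2 - r₂ * x 1 + q - 1) / q ≤ x 0 := by
      refine Nat.lt_succ_iff.mp ((Nat.div_lt_iff_lt_mul hq).mpr ?_)
      have : (x 0 + 1) * q = q * x 0 + q := by ring
      rw [Nat.succ_eq_add_one, this]
      omega
    exact Ideal.pow_le_pow_right he (Ideal.pow_mem_pow hu0 _)

end Intrinsic
end Summit.ResolutionOfSingularities.ResolutionOfSingularities.Cruxes.HypersurfaceCentreConstruction.LocalEngine.Iota3
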